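import Literature.AlgebraicGeometry.Resolution.BlowupStalkBlowupAlgebra
import Literature.AlgebraicGeometry.Resolution.BlowupChartMembership
import Literature.AlgebraicGeometry.Resolution.BlowupChartModule
import Literature.AlgebraicGeometry.Resolution.BlowupAlgebraLift
import Literature.AlgebraicGeometry.Resolution.BlowupAlgebraPresentation
import Literature.AlgebraicGeometry.Resolution.HypersurfaceTransform
import HarnessLib

/-!
# [OURS · L1 W4.5(b) · EL♮(3)] HSUB(ReachTC⁺)₃ / inv_base brick B1★ = T-PRES-CHART: the local ring of a blow-up is a localisation of
# the affine blowup algebra on the PRESCRIBED chart `c_j` whenever `π♯(c_j)` generates the exceptional stalk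

Crux `EquisingularLiftNat` = stmt-ResolutionOfSingularities-20038 (child EL♮(3) = stmt-ResolutionOfSingularities-20148), route
EquisingularLift, line `sections`; registered stub `stub_elnat_tcPlusPointResolution`, res-L1-w45b-stub-1's HSUB′(ReachTC⁺)₃ assembly,
brick `inv_base` (res-type-100), sub-brick B1★ of res-type-100's SIZED DECOMPOSITION 2026-08-27T13:39:56Z, dealt to res-D-pv-029 by
res-L1-w45b-stub-1's RULING 13:44:20Z (3). Helper file `--supports stmt-ResolutionOfSingularities-20148 --as helper` by res-D-pv-029.
HONEST FRAMING: OURS (cell res-hironaka, slot W4.5(b)); NOT a statement of any manuscript; AI-written, weaker than expert review.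
No `sorry`; standard axioms.

WHAT. Literature `IsBlowup.exists_blowupAlgebra_stalk_ringEquiv(_of_eq)` (BlowupStalkBlowupAlgebra, Stacks 0804) presents
`𝒪_{X′,x′}` as a localisation `R[I/c_i]_𝔔` of the affine blowup algebra on SOME chart `i` (`R = 𝒪_{X,s}`, `I = (c) = J_s`). res-type-100's
inv_base clause (v) at the NON-cone special points needs the chart PRESCRIBED: if `π♯(c_j)` generates the exceptional stalk
`(J·𝒪_{X′})_{x′}` then `𝒪_{X′,x′}` is a localisation of `R[I/c_j]` at a prime over `𝔪_s`, through a ring map `χ` extending `π♯_{x′}`.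

* `isUnit_of_span_singleton_eq_of_mul_eq` — if `(a) = (b)` with `b` a non-zero-divisor and `u·b = a` then `u` is a unit;
* `blowupAlgebra.mk_div_pow_mul_pow`, `blowupAlgebra.exists_eq_mk_div_pow` — the elements `y/aⁿ ∈ R[I/a]`, `y ∈ Iⁿ`, and `(y/aⁿ)·aⁿ = y` (def-free);
* **`exists_blowupAlgebra_stalk_ringEquiv_of_stalkIdeal_eq_span`** — the statement (res-type-100's text VERBATIM). ROUTE (universal
  properties only, no `Proj`): `χ := blowupAlgebra.lift` (BlowupAlgebraLift, GW (13.19): `π♯(c_j)` is a non-zero-divisor because the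
  exceptional ideal is effective Cartier, and `I·𝒪_{X′,x′} = (π♯ c_j)`), `𝔔 := χ⁻¹ 𝔪_{x′}`; the localisation axioms are moved over
  from the chart-`i` presentation: `u = χ(c_i/c_j)` is a UNIT (`(π♯ c_i) = (π♯ c_j)` both generate the exceptional stalk), every
  `b = y/c_iⁿ ∈ R[I/c_i]` (Stacks 052Q, `blowupAlgebra.exists_eq_mul_invSelf_pow`) has `χ_i(b)·uⁿ = χ(y/c_jⁿ)`, which gives
  surjectivity of fractions and the kernel condition (`c_iᴺ y′ y = 0` ⇒ `(y′ c_iᴺ / c_j^{m+N}) · (y/c_jⁿ) = 0` with a unit image).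

References: U. Görtz, T. Wedhorn, *Algebraic Geometry I* (2020), (13.19) p. 415; The Stacks Project, Tags 0804, 052Q, 07Z3.
Tree inputs: Literature BlowupStalkBlowupAlgebra / BlowupAlgebraLift / BlowupChartMembership / BlowupChartModule / AffineBlowupAlgebra.
-/

set_option linter.dupNamespace false -- mandated namespace `Summit.<Summit>.<Problem>` of this single-conjunct summit

noncomputable section

open CategoryTheory AlgebraicGeometry TopologicalSpace IsLocalRing IsLocalization
open Literature.AlgebraicGeometry.Resolution

namespace Summit.ResolutionOfSingularities.ResolutionOfSingularities.Cruxes.EquisingularLiftNat.Sections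

universe u

/-! ## 1. Two ring lemmas -/

/-- If `(a) = (b)` with `b` a non-zero-divisor and `u · b = a`, then `u` is a unit (the two generators differ by a unit, and the
cofactor is determined). [folklore] -/
theorem isUnit_of_span_singleton_eq_of_mul_eq {S : Type*} [CommRing S] {a b u : S}
    (h : Ideal.span {a} = Ideal.span {b}) (hb : b ∈ nonZeroDivisors S) (hu : u * b = a) : IsUnit u := by
  have ha : a ∈ Ideal.span {b} := h ▸ Ideal.mem_span_singleton_self a
  have hb' : b ∈ Ideal.span {a} := h.symm ▸ Ideal.mem_span_singleton_self b
  obtain ⟨v, hv⟩ := Ideal.mem_span_singleton'.mp ha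
  obtain ⟨w, hw⟩ := Ideal.mem_span_singleton'.mp hb'
  -- `w v = 1`
  have h1 : w * v = 1 := by
    have h2 : (w * v - 1) * b = 0 := by rw [sub_mul, one_mul, mul_assoc, hv, hw, sub_self]
    exact sub_eq_zero.mp ((mem_nonZeroDivisors_iff_right.mp hb) _ h2)
  -- `u = v`
  have h3 : u = v := by
    have h4 : (u - v) * b = 0 := by rw [sub_mul, hu, hv, sub_self]
    exact sub_eq_zero.mp ((mem_nonZeroDivisors_iff_right.mp hb) _ h4)
  rw [h3]
  exact isUnit_iff_exists_inv.mpr ⟨w, by rw [mul_comm, h1]⟩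

section DivPow

variable {R : Type u} [CommRing R] (I : Ideal R) (a : R)

/-- `(y/aⁿ) · aⁿ = y` in `R[I/a]`, for the element `y/aⁿ = ⟨y/1 · (1/a)ⁿ, _⟩` (`y ∈ Iⁿ`, Stacks 052Q). [cite: StacksProject, Tag 052Q] -/
theorem blowupAlgebra.mk_div_pow_mul_pow (n : ℕ) (y : R) (hy : y ∈ I ^ n) :
    (⟨algebraMap R (Localization.Away a) y * Away.invSelf a ^ n, algebraMap_mul_invSelf_pow_mem_blowupAlgebra a n hy⟩ :
        blowupAlgebra I a) * algebraMap R (blowupAlgebra I a) a ^ n = algebraMap R (blowupAlgebra I a) y := by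
  apply Subtype.ext
  change (algebraMap R (Localization.Away a) y * Away.invSelf a ^ n) * algebraMap R (Localization.Away a) a ^ n =
    algebraMap R (Localization.Away a) y
  rw [mul_assoc, mul_comm (Away.invSelf a ^ n), ← map_pow, algebraMap_pow_mul_invSelf_pow, mul_one]

/-- Every element of `R[I/a]` (`a ∈ I`) is some `y/aⁿ`, `y ∈ Iⁿ` (Stacks 052Q; `blowupAlgebra.exists_eq_mul_invSelf_pow` as an equation of
elements of the subalgebra). [cite: StacksProject, Tag 052Q] -/
theorem blowupAlgebra.exists_eq_mk_div_pow (ha : a ∈ I) (b : blowupAlgebra I a) :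
    ∃ (n : ℕ) (y : R) (hy : y ∈ I ^ n),
      b = ⟨algebraMap R (Localization.Away a) y * Away.invSelf a ^ n, algebraMap_mul_invSelf_pow_mem_blowupAlgebra a n hy⟩ := by
  obtain ⟨n, y, hy, h⟩ := blowupAlgebra.exists_eq_mul_invSelf_pow I a ha b.2
  exact ⟨n, y, hy, Subtype.ext h⟩

end DivPow

/-! ## 2. The presentation on a prescribed chart -/

/-- A ring map `ψ : R[I/a] → O` over `φ` evaluates `y/aⁿ` as the cofactor: `ψ(y/aⁿ) · φ(a)ⁿ = φ(y)`. [folklore] -/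
theorem apply_mk_div_pow_mul_pow {R O : Type u} [CommRing R] [CommRing O] {I : Ideal R} {a : R} (ψ : blowupAlgebra I a →+* O)
    (φ : R →+* O) (hψ : ∀ r, ψ (algebraMap R (blowupAlgebra I a) r) = φ r) (n : ℕ) (y : R) (hy : y ∈ I ^ n) :
    ψ ⟨algebraMap R (Localization.Away a) y * Away.invSelf a ^ n, algebraMap_mul_invSelf_pow_mem_blowupAlgebra a n hy⟩ *
      φ a ^ n = φ y := by
  rw [← hψ a, ← map_pow, ← map_mul, blowupAlgebra.mk_div_pow_mul_pow I a n y hy, hψ]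

/-- A ring map `ψ : R[I/c_i] → O` over `φ` evaluates the fraction `c_l/c_i` as the cofactor: `ψ(c_l/c_i) · φ(c_i) = φ(c_l)`. [folklore] -/
theorem apply_frac_mul {R O : Type u} [CommRing R] [CommRing O] {k : ℕ} (c : Fin k → R) (i l : Fin k)
    (ψ : blowupAlgebra (Ideal.span (Set.range c)) (c i) →+* O) (φ : R →+* O)
    (hψ : ∀ r, ψ (algebraMap R _ r) = φ r) : ψ (blowupAlgebra.frac c i l) * φ (c i) = φ (c l) := by
  rw [← hψ (c i), ← map_mul]
  change ψ (blowupAlgebra.gen _ _ _ _ * _) = _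
  rw [blowupAlgebra.gen_mul_algebraMap, hψ]

set_option maxHeartbeats 800000 in -- two localisation structures on `𝒪_{X′,x′}` and the subalgebra model of `R[I/a]` unify slowly
/-- **T-PRES-CHART: the local ring of a blow-up on a PRESCRIBED chart.** For a blow-up `π : X′ → X` along `J`, `x′ ∈ X′` over `s`,
generators `c` of `J_s`, and an index `j` such that `π♯_{x′}(c_j)` generates the exceptional stalk `(J·𝒪_{X′})_{x′}`: there are a prime `𝔔`
of `R[I/c_j]` over `𝔪_s`, a ring map `χ : R[I/c_j] → 𝒪_{X′,x′}` extending `π♯_{x′}` and presenting `𝒪_{X′,x′}` as the localisation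
`R[I/c_j]_𝔔`, and a ring isomorphism `e : 𝒪_{X′,x′} ≅ R[I/c_j]_𝔔` with `e (χ b) = b/1`. [cite: StacksProject, Tag 0804]
[cite: GortzWedhorn2020, (13.19) p. 415] [OURS · L1 W4.5b] brick B1★ of inv_base toward `stub_elnat_tcPlusPointResolution`
(stmt-ResolutionOfSingularities-20148 / -20038); NOT a statement of the manuscript. -/
theorem exists_blowupAlgebra_stalk_ringEquiv_of_stalkIdeal_eq_span {X X' : Scheme.{u}} {π : X' ⟶ X}
    {J : X.IdealSheafData} (hπ : IsBlowup π J) (x' : X') {k : ℕ} (c : Fin k → X.presheaf.stalk (π x'))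
    (hc : Ideal.span (Set.range c) = stalkIdeal J (π x')) (j : Fin k)
    (hj : stalkIdeal (J.comap π) x' = Ideal.span {(π.stalkMap x').hom (c j)}) :
    ∃ (𝔔 : PrimeSpectrum (blowupAlgebra (Ideal.span (Set.range c)) (c j)))
      (χ : blowupAlgebra (Ideal.span (Set.range c)) (c j) →+* X'.presheaf.stalk x')
      (e : X'.presheaf.stalk x' ≃+* Localization.AtPrime 𝔔.asIdeal),
      (∀ a, χ (algebraMap _ _ a) = (π.stalkMap x').hom a) ∧
      @IsLocalization.AtPrime _ _ (X'.presheaf.stalk x') _ χ.toAlgebra 𝔔.asIdeal _ ∧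
      (∀ b, e (χ b) = algebraMap _ (Localization.AtPrime 𝔔.asIdeal) b) ∧
      𝔔.asIdeal.comap (algebraMap _ (blowupAlgebra (Ideal.span (Set.range c)) (c j))) =
        maximalIdeal (X.presheaf.stalk (π x')) := by
  classical
  -- notation
  have hcI : ∀ l, c l ∈ Ideal.span (Set.range c) := fun l => Ideal.subset_span (Set.mem_range_self l)
  -- the chart-`i` presentation of the tree
  obtain ⟨i, 𝔔ᵢ, χᵢ, eᵢ, hχᵢ, hlocᵢ, -, h𝔔ᵢ⟩ := hπ.exists_blowupAlgebra_stalk_ringEquiv x' c hc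
  -- `I · 𝒪_{X′,x′} = (π♯ c_j)`, and `π♯ c_j` is a non-zero-divisor
  have hE : (Ideal.span (Set.range c)).map (π.stalkMap x').hom = Ideal.span {(π.stalkMap x').hom (c j)} := by
    rw [hc, ← stalkIdeal_comap_eq_map_stalkMap, hj]
  have hnzd : (π.stalkMap x').hom (c j) ∈ nonZeroDivisors (X'.presheaf.stalk x') := by
    obtain ⟨t, ht, hKt⟩ := hπ.isEffectiveCartier.exists_stalkIdeal_eq_span x'
    rw [hj] at hKt
    exact mem_nonZeroDivisors_of_span_singleton_eq hKt ht
  -- the lift `χ : R[I/c_j] → 𝒪_{X′,x′}` of `π♯_{x′}`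
  let χ : blowupAlgebra (Ideal.span (Set.range c)) (c j) →+* X'.presheaf.stalk x' :=
    blowupAlgebra.lift (Ideal.span (Set.range c)) hnzd hE.le
  have hχ : ∀ a, χ (algebraMap _ _ a) = (π.stalkMap x').hom a :=
    blowupAlgebra.lift_algebraMap (Ideal.span (Set.range c)) hnzd hE.le
  -- `𝔔 := χ⁻¹ 𝔪`
  let 𝔔 : PrimeSpectrum (blowupAlgebra (Ideal.span (Set.range c)) (c j)) :=
    ⟨(maximalIdeal (X'.presheaf.stalk x')).comap χ, Ideal.comap_isPrime χ _⟩
  have hmem𝔔 : ∀ b, b ∈ 𝔔.asIdeal ↔ χ b ∈ maximalIdeal (X'.presheaf.stalk x') := fun b => Iff.rfl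
  have hunit𝔔 : ∀ b, b ∉ 𝔔.asIdeal ↔ IsUnit (χ b) := fun b => by
    rw [hmem𝔔, mem_maximalIdeal, mem_nonunits_iff, not_not]
  -- chart-`i` facts, as plain statements
  have hunitᵢ : ∀ s, s ∉ 𝔔ᵢ.asIdeal → IsUnit (χᵢ s) := fun s hs => by
    letI := χᵢ.toAlgebra
    exact @IsLocalization.map_units _ _ _ _ _ _ hlocᵢ ⟨s, hs⟩
  have hsurjᵢ : ∀ z : X'.presheaf.stalk x', ∃ b s, s ∉ 𝔔ᵢ.asIdeal ∧ z * χᵢ s = χᵢ b := fun z => by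
    letI := χᵢ.toAlgebra
    obtain ⟨⟨b, s⟩, h⟩ := @IsLocalization.surj _ _ _ _ _ _ hlocᵢ z
    exact ⟨b, s.1, s.2, h⟩
  have heqᵢ : ∀ a b, χᵢ a = χᵢ b → ∃ s, s ∉ 𝔔ᵢ.asIdeal ∧ s * a = s * b := fun a b h => by
    letI := χᵢ.toAlgebra
    obtain ⟨s, hs⟩ := @IsLocalization.exists_of_eq _ _ _ _ _ _ hlocᵢ a b h
    exact ⟨s.1, s.2, hs⟩
  -- `(π♯ c_i) = (π♯ c_j)`: both generate the exceptional stalk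
  have hEᵢ : (Ideal.span (Set.range c)).map (π.stalkMap x').hom = Ideal.span {(π.stalkMap x').hom (c i)} := by
    have hcomp : χᵢ.comp (algebraMap _ _) = (π.stalkMap x').hom := RingHom.ext hχᵢ
    rw [← hcomp, ← Ideal.map_map, map_blowupAlgebra_eq_span (hcI i), Ideal.map_span, Set.image_singleton, RingHom.comp_apply]
  -- the unit `u = χ(c_i/c_j)` with `u · π♯(c_j) = π♯(c_i)`, and its inverse `u′ = χᵢ(c_j/c_i)`
  have hu_mul : χ (blowupAlgebra.frac c j i) * (π.stalkMap x').hom (c j) = (π.stalkMap x').hom (c i) :=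
    apply_frac_mul c j i χ _ hχ
  have hu : IsUnit (χ (blowupAlgebra.frac c j i)) :=
    isUnit_of_span_singleton_eq_of_mul_eq (hEᵢ.symm.trans hE) hnzd hu_mul
  have hfrac𝔔 : blowupAlgebra.frac c j i ∉ 𝔔.asIdeal := (hunit𝔔 _).mpr hu
  have hu'_mul : χᵢ (blowupAlgebra.frac c i j) * (π.stalkMap x').hom (c i) = (π.stalkMap x').hom (c j) :=
    apply_frac_mul c i j χᵢ _ hχᵢ
  -- comparison of the two charts on fractions `y/c_iⁿ` versus `y/c_jⁿ`
  have hcomp : ∀ (n : ℕ) (y : X.presheaf.stalk (π x')) (hy : y ∈ Ideal.span (Set.range c) ^ n),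
      χᵢ ((⟨algebraMap _ (Localization.Away (c i)) y * Away.invSelf (c i) ^ n, algebraMap_mul_invSelf_pow_mem_blowupAlgebra (c i) n hy⟩ : blowupAlgebra (Ideal.span (Set.range c)) (c i))) * χ (blowupAlgebra.frac c j i) ^ n =
        χ ((⟨algebraMap _ (Localization.Away (c j)) y * Away.invSelf (c j) ^ n, algebraMap_mul_invSelf_pow_mem_blowupAlgebra (c j) n hy⟩ : blowupAlgebra (Ideal.span (Set.range c)) (c j))) := by
    intro n y hy
    have h1 := apply_mk_div_pow_mul_pow χᵢ _ hχᵢ n y hy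
    have h2 := apply_mk_div_pow_mul_pow χ _ hχ n y hy
    -- `χᵢ(y/c_iⁿ) · uⁿ · (π♯ c_j)ⁿ = φ y = χ(y/c_jⁿ) · (π♯ c_j)ⁿ`
    have h3 : χᵢ ((⟨algebraMap _ (Localization.Away (c i)) y * Away.invSelf (c i) ^ n, algebraMap_mul_invSelf_pow_mem_blowupAlgebra (c i) n hy⟩ : blowupAlgebra (Ideal.span (Set.range c)) (c i))) * χ (blowupAlgebra.frac c j i) ^ n *
        (π.stalkMap x').hom (c j) ^ n = χ ((⟨algebraMap _ (Localization.Away (c j)) y * Away.invSelf (c j) ^ n, algebraMap_mul_invSelf_pow_mem_blowupAlgebra (c j) n hy⟩ : blowupAlgebra (Ideal.span (Set.range c)) (c j))) * (π.stalkMap x').hom (c j) ^ n := by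
      rw [h2, mul_assoc, ← mul_pow, hu_mul, h1]
    exact (mul_cancel_right_mem_nonZeroDivisors (pow_mem hnzd n)).mp h3
  -- THE LOCALISATION STRUCTURE along `χ`
  letI hAlg : Algebra (blowupAlgebra (Ideal.span (Set.range c)) (c j)) (X'.presheaf.stalk x') := χ.toAlgebra
  have hloc : IsLocalization.AtPrime (X'.presheaf.stalk x') 𝔔.asIdeal := by
    refine { map_units := ?_, surj := ?_, exists_of_eq := ?_ }
    · intro s
      exact (hunit𝔔 s.1).mp s.2
    · intro z
      obtain ⟨b, s, hs, hz⟩ := hsurjᵢ z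
      obtain ⟨n, y, hy, rfl⟩ := blowupAlgebra.exists_eq_mk_div_pow _ (c i) (hcI i) b
      obtain ⟨m, y', hy', rfl⟩ := blowupAlgebra.exists_eq_mk_div_pow _ (c i) (hcI i) s
      -- `w = y/c_jⁿ`, `w′ = y′/c_j^m`
      have hw := hcomp n y hy
      have hw' := hcomp m y' hy'
      have hunitw' : IsUnit (χ ((⟨algebraMap _ (Localization.Away (c j)) y' * Away.invSelf (c j) ^ m, algebraMap_mul_invSelf_pow_mem_blowupAlgebra (c j) m hy'⟩ : blowupAlgebra (Ideal.span (Set.range c)) (c j)))) := by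
        rw [← hw']; exact (hunitᵢ _ hs).mul (hu.pow m)
      refine ⟨⟨(⟨algebraMap _ (Localization.Away (c j)) y * Away.invSelf (c j) ^ n, algebraMap_mul_invSelf_pow_mem_blowupAlgebra (c j) n hy⟩ : blowupAlgebra (Ideal.span (Set.range c)) (c j)) * blowupAlgebra.frac c j i ^ m,
        ⟨(⟨algebraMap _ (Localization.Away (c j)) y' * Away.invSelf (c j) ^ m, algebraMap_mul_invSelf_pow_mem_blowupAlgebra (c j) m hy'⟩ : blowupAlgebra (Ideal.span (Set.range c)) (c j)) * blowupAlgebra.frac c j i ^ n, ?_⟩⟩, ?_⟩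
      · -- outside `𝔔`: a product of elements with unit image
        show (⟨algebraMap _ (Localization.Away (c j)) y' * Away.invSelf (c j) ^ m, algebraMap_mul_invSelf_pow_mem_blowupAlgebra (c j) m hy'⟩ : blowupAlgebra (Ideal.span (Set.range c)) (c j)) * blowupAlgebra.frac c j i ^ n ∉ 𝔔.asIdeal
        rw [hunit𝔔, map_mul, map_pow]
        exact hunitw'.mul (hu.pow n)
      · change z * χ ((⟨algebraMap _ (Localization.Away (c j)) y' * Away.invSelf (c j) ^ m, algebraMap_mul_invSelf_pow_mem_blowupAlgebra (c j) m hy'⟩ : blowupAlgebra (Ideal.span (Set.range c)) (c j)) * blowupAlgebra.frac c j i ^ n) =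
          χ ((⟨algebraMap _ (Localization.Away (c j)) y * Away.invSelf (c j) ^ n, algebraMap_mul_invSelf_pow_mem_blowupAlgebra (c j) n hy⟩ : blowupAlgebra (Ideal.span (Set.range c)) (c j)) * blowupAlgebra.frac c j i ^ m)
        rw [map_mul, map_pow, map_mul, map_pow, ← hw, ← hw']
        calc z * (χᵢ ((⟨algebraMap _ (Localization.Away (c i)) y' * Away.invSelf (c i) ^ m, algebraMap_mul_invSelf_pow_mem_blowupAlgebra (c i) m hy'⟩ : blowupAlgebra (Ideal.span (Set.range c)) (c i))) * χ (blowupAlgebra.frac c j i) ^ m *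
              χ (blowupAlgebra.frac c j i) ^ n)
            = (z * χᵢ ((⟨algebraMap _ (Localization.Away (c i)) y' * Away.invSelf (c i) ^ m, algebraMap_mul_invSelf_pow_mem_blowupAlgebra (c i) m hy'⟩ : blowupAlgebra (Ideal.span (Set.range c)) (c i)))) *
                (χ (blowupAlgebra.frac c j i) ^ m * χ (blowupAlgebra.frac c j i) ^ n) := by ring
          _ = χᵢ ((⟨algebraMap _ (Localization.Away (c i)) y * Away.invSelf (c i) ^ n, algebraMap_mul_invSelf_pow_mem_blowupAlgebra (c i) n hy⟩ : blowupAlgebra (Ideal.span (Set.range c)) (c i))) *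
                (χ (blowupAlgebra.frac c j i) ^ m * χ (blowupAlgebra.frac c j i) ^ n) := by rw [hz]
          _ = _ := by ring
    · intro a b hab
      change χ a = χ b at hab
      -- `χ (a - b) = 0`; write `a - b = y/c_jⁿ`
      obtain ⟨n, y, hy, hd⟩ := blowupAlgebra.exists_eq_mk_div_pow _ (c j) (hcI j) (a - b)
      have hφy : (π.stalkMap x').hom y = 0 := by
        have h1 := apply_mk_div_pow_mul_pow χ _ hχ n y hy
        rw [← hd, map_sub, hab, sub_self, zero_mul] at h1
        exact h1.symm
      -- downstairs on chart `i`: `χᵢ (y/1) = 0`, so `s′ · (y/1) = 0` for some `s′ = y′/c_i^m ∉ 𝔔ᵢ`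
      obtain ⟨s', hs', hs'y⟩ := heqᵢ (algebraMap _ _ y) 0 (by rw [hχᵢ, hφy, map_zero])
      obtain ⟨m, y', hy', rfl⟩ := blowupAlgebra.exists_eq_mk_div_pow _ (c i) (hcI i) s'
      rw [mul_zero] at hs'y
      -- `c_i^N · y′ · y = 0` in `R`
      have hzero : ∃ N : ℕ, c i ^ N * (y' * y) = 0 := by
        have h1 : (algebraMap _ (Localization.Away (c i)) y' * Away.invSelf (c i) ^ m) *
            algebraMap _ (Localization.Away (c i)) y = 0 := by
          have h2 := congrArg Subtype.val hs'y
          exact h2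
        have h3 : algebraMap _ (Localization.Away (c i)) (y' * y) = 0 := by
          have h4 : algebraMap _ (Localization.Away (c i)) (y' * y) =
              (algebraMap _ (Localization.Away (c i)) y' * Away.invSelf (c i) ^ m) *
                algebraMap _ (Localization.Away (c i)) y * algebraMap _ (Localization.Away (c i)) (c i ^ m) := by
            rw [map_mul]
            calc algebraMap _ (Localization.Away (c i)) y' * algebraMap _ (Localization.Away (c i)) y
                = algebraMap _ _ y' * algebraMap _ _ y *
                    (algebraMap _ (Localization.Away (c i)) (c i ^ m) * Away.invSelf (c i) ^ m) := by
                  rw [algebraMap_pow_mul_invSelf_pow, mul_one]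
              _ = _ := by ring
          rw [h4, h1, zero_mul]
        obtain ⟨⟨_, N, rfl⟩, hN⟩ := (IsLocalization.map_eq_zero_iff (Submonoid.powers (c i)) _ _).mp h3
        exact ⟨N, hN⟩
      obtain ⟨N, hN⟩ := hzero
      -- the multiplier `s := (y′ c_iᴺ) / c_j^{m+N}`
      have hyN : y' * c i ^ N ∈ Ideal.span (Set.range c) ^ (m + N) := by
        rw [pow_add]; exact Ideal.mul_mem_mul hy' (Ideal.pow_mem_pow (hcI i) N)
      refine ⟨⟨(⟨algebraMap _ (Localization.Away (c j)) (y' * c i ^ N) * Away.invSelf (c j) ^ (m + N), algebraMap_mul_invSelf_pow_mem_blowupAlgebra (c j) (m + N) hyN⟩ : blowupAlgebra (Ideal.span (Set.range c)) (c j)), ?_⟩, ?_⟩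
      · -- `χ s` is a unit: `χ s · (π♯ c_j)^{m+N} = φ(y′) φ(c_i)^N = χᵢ(s′) u^{m+N} (π♯ c_j)^{m+N}`
        show (⟨algebraMap _ (Localization.Away (c j)) (y' * c i ^ N) * Away.invSelf (c j) ^ (m + N), algebraMap_mul_invSelf_pow_mem_blowupAlgebra (c j) (m + N) hyN⟩ : blowupAlgebra (Ideal.span (Set.range c)) (c j)) ∉ 𝔔.asIdeal
        rw [hunit𝔔]
        have h1 := apply_mk_div_pow_mul_pow χ _ hχ (m + N) (y' * c i ^ N) hyN
        have h2 := apply_mk_div_pow_mul_pow χᵢ _ hχᵢ m y' hy'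
        have h3 : χ ((⟨algebraMap _ (Localization.Away (c j)) (y' * c i ^ N) * Away.invSelf (c j) ^ (m + N), algebraMap_mul_invSelf_pow_mem_blowupAlgebra (c j) (m + N) hyN⟩ : blowupAlgebra (Ideal.span (Set.range c)) (c j))) * (π.stalkMap x').hom (c j) ^ (m + N) =
            (χᵢ ((⟨algebraMap _ (Localization.Away (c i)) y' * Away.invSelf (c i) ^ m, algebraMap_mul_invSelf_pow_mem_blowupAlgebra (c i) m hy'⟩ : blowupAlgebra (Ideal.span (Set.range c)) (c i))) * χ (blowupAlgebra.frac c j i) ^ (m + N)) *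
              (π.stalkMap x').hom (c j) ^ (m + N) := by
          rw [h1, map_mul, map_pow, ← h2, ← hu_mul]; ring
        rw [(mul_cancel_right_mem_nonZeroDivisors (pow_mem hnzd (m + N))).mp h3]
        exact (hunitᵢ _ hs').mul (hu.pow (m + N))
      · -- `s · a = s · b`: `s · (a - b) = (y′ c_iᴺ y)/c_j^{m+N+n} = 0`
        change (⟨algebraMap _ (Localization.Away (c j)) (y' * c i ^ N) * Away.invSelf (c j) ^ (m + N), algebraMap_mul_invSelf_pow_mem_blowupAlgebra (c j) (m + N) hyN⟩ : blowupAlgebra (Ideal.span (Set.range c)) (c j)) * a =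
          (⟨algebraMap _ (Localization.Away (c j)) (y' * c i ^ N) * Away.invSelf (c j) ^ (m + N), algebraMap_mul_invSelf_pow_mem_blowupAlgebra (c j) (m + N) hyN⟩ : blowupAlgebra (Ideal.span (Set.range c)) (c j)) * b
        rw [← sub_eq_zero, ← mul_sub, hd]
        apply Subtype.ext
        change (algebraMap _ (Localization.Away (c j)) (y' * c i ^ N) * Away.invSelf (c j) ^ (m + N)) *
          (algebraMap _ (Localization.Away (c j)) y * Away.invSelf (c j) ^ n) = 0
        have h5 : algebraMap _ (Localization.Away (c j)) (y' * c i ^ N) * algebraMap _ (Localization.Away (c j)) y = 0 := by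
          rw [← map_mul, show y' * c i ^ N * y = c i ^ N * (y' * y) by ring, hN, map_zero]
        calc (algebraMap _ (Localization.Away (c j)) (y' * c i ^ N) * Away.invSelf (c j) ^ (m + N)) *
              (algebraMap _ (Localization.Away (c j)) y * Away.invSelf (c j) ^ n)
            = (algebraMap _ (Localization.Away (c j)) (y' * c i ^ N) * algebraMap _ (Localization.Away (c j)) y) *
                (Away.invSelf (c j) ^ (m + N) * Away.invSelf (c j) ^ n) := by ring
          _ = 0 := by rw [h5, zero_mul]
  -- the isomorphism `e : 𝒪_{X′,x′} ≅ R[I/c_j]_𝔔` and the assembly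
  haveI := hloc
  let eA := IsLocalization.algEquiv 𝔔.asIdeal.primeCompl (X'.presheaf.stalk x') (Localization.AtPrime 𝔔.asIdeal)
  refine ⟨𝔔, χ, eA.toRingEquiv, hχ, hloc, fun b => eA.commutes b, ?_⟩
  change ((maximalIdeal (X'.presheaf.stalk x')).comap χ).comap (algebraMap _ _) = _
  rw [Ideal.comap_comap, show χ.comp (algebraMap _ _) = (π.stalkMap x').hom from RingHom.ext hχ]
  exact IsLocalRing.maximalIdeal_comap _

end Summit.ResolutionOfSingularities.ResolutionOfSingularities.Cruxes.EquisingularLiftNat.Sections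

end
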